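import Summits.QuantumFields.BalabanUV.Beta.FP.TransportInfinity
import Summits.QuantumFields.BalabanUV.Beta.FP.PerfectObjectsT

/-!
# `BalabanUV.Beta.FP.TransportInfinityM` — road «FP» for binder row D1, leaf N5b-2: the PERFECT `m`-STEP TRANSPORT — the `(inl, inr)` column of the
# (j, m)-resolvent `FP.PerfectObjects.KTot (Lc^(j+m)) (Lc^j)` (= `dec (Lc^j) (KInv (Lc^(j+m)))`), renormalised by `Lc^{5j}` — REPRODUCES CONSTANTS
# through `Lc^m • ℤ⁴` with the Kronecker coset mass `(Lc^m)⁻⁵`, REPRODUCES LINEAR DATA and has absolutely summable second moments AT EVERY `j`;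
# these Strang–Fix data are CLOSED under dominated entrywise limits (`FP/TransportLimit`), so ANY entrywise limit `wInf` of the family (in particular
# the column of the perfect `m`-step resolvent `KPerf … m` in bond units `s_f·s_m = Lc^{5j}`) is an ADMISSIBLE transport weight at blocking `Lc^m`
# (`DressedMomentNormalisation.EntryHyps (Lc^m) wInf 𝒯`) and the TRANSPORT-INVARIANCE IDENTITY of the marginal (second-moment) tensor holds for it:
# `m2Tensor ((Lc^m)^8 · dressedEntry wInf 𝒯 (Lc^m • ·)) = m2Tensor 𝒯` (an4's `HessianTelescopingKKT.hasSum_transport_m2Tensor` BY NAME, `w := wInf`)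

HONEST FRAMING (cell contract, verbatim): «discharging `BetaPertH` makes Bałaban's UV stability UNCONDITIONAL — a real constructive-QFT result;
it is NOT the continuum limit and NOT the Clay problem.»  THIS MODULE DISCHARGES NOTHING: it is an4's finite-level Strang–Fix bookkeeping
(`constReproSum_stepCol` / `linReproSum_stepCol`, blocking `Lc`) redone ONE PARAMETER UP (coset modulus `Lc^m`, fine kernel `wH_{Lc^{j+m}}`,
`KernelSpecInstance.lowMomentsSum_specK` + `constReproSum_dilate` / `linReproSum_dilate` with `(M, L) = (Lc^j, Lc^m)`), then Tannery
(`FP/TransportLimit`, `FP/TransportInfinity` §1–§2 BY NAME).  Entrywise convergence of the (j, m)-families and the `j`-uniform exponential majorant are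
HYPOTHESES (row G-an2-4 / sub-leaf X1m of the skeleton); (T0)/(T1)/AbsMoment₂ of the transported kernel `𝒯` are HYPOTHESES (leaves N3/N4).
Skeleton `HOME/beta/skeletons/D1-b2b-balaban-beta-d1-p3.md` leaf N5; claim table `HOME/b2b-balaban-beta-d1-p3/LEAVES-FP.md` row N5b-2
(unit `b2b-balaban-beta-d1-formalise-leaf-02`, D1 formalisation swarm).  NOT BetaPertH, NOT continuum, NOT Clay.
ABSOLUTE RULE (cell, verbatim): «No internally-minted statement may enter as a cited fact. Every hypothesis is either kernel-proved in this package or a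
verbatim quotation of a PUBLISHED theorem with page reference.»  Nothing is cited; no `def … : Prop`; the two `def`s below are OBJECTS (a column pattern and
its renormalisation), the `m`-step twins of an4's `HessianTelescopingKKT.stepCol` / `wStep` (`stepColM … j 1 = stepCol … j`, `wStepM Lc 1 = wStep Lc` by `rfl`).

CONTENT.
§1 FINITE LEVEL (generic `d` where free): `stepColM Lc j m κ l p := KTot (Lc^(j+m)) (Lc^j) (−p) 0 (inl κ) (inr l)`; `stepColM_one`; `stepColM_eq` (block-contour MEAN,
   weights `(Lc^j)^{−(d+2)}`, of `wH_{Lc^{j+m}}` over the leg offsets); **`constReproSum_stepColM`** (`ConstReproSum (Lc^m) (stepColM Lc j m κ l) (δ_{κl}·((Lc^{j+m})^{d+2})⁻¹)`),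
   `linReproSum_stepColM`, `decays_KTot`, `absMoment₂_stepColM`; the renormalised weight `wStepM Lc m j κ l p := Lc^{5j} · stepColM (d := 3) Lc j m κ l p`, `wStepM_one`,
   **`constReproSum_wStepM`** (mass `δ_{κl}·((Lc^m)^{4+1})⁻¹` — EXACTLY the `EntryHyps (Lc^m)` shape), `linReproSum_wStepM`, `absMoment₂_wStepM`, `entryHyps_wStepM`
   (finite-`j` admissibility at blocking `Lc^m` for ANY kernel `𝒯` with AbsMoment₂/(T0)/(T1)).
§2 THE LIMIT: for ANY entrywise limit `wInf` of `j ↦ wStepM Lc m j` under a `j`-uniform exponential majorant: `decay510_of_tendsto`, `constReproSum_of_tendsto_wStepM`,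
   `exists_linReproSum_of_tendsto_wStepM`, `absMoment₂_of_tendsto_wStepM`, **`entryHyps_of_tendsto_wStepM`**, **`coarseTensor_eq_m2Tensor_of_tendsto_wStepM`** /
   **`hasSum_transport_m2Tensor_of_tendsto_wStepM`** (the transport-invariance identity at the fixed point).
§3 DICTIONARY to the perfect objects: `unitK_apply_inl_inr`, `unitK_KTot_column` (in bond units `s_f(j)·s_m(j) = Lc^{5j}` the `(inl κ, inr l)` entry of
   `unitK (sf j) (sm j) (KTot (Lc^(j+m)) (Lc^j))` at `(−p, 0)` IS `wStepM Lc m j κ l p`), `abs_wStepM_le_of_decays` (the majorant from a `j`-uniform `Decays` bound of the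
   rescaled family), `tendsto_wStepM_of_tendsto` (entrywise convergence of the rescaled family ⇒ of the weights, limit = the column `perfCol` of `KPerf … m`),
   `tendsto_wStepM_of_decays` (the same from the cell's all-scales `Decays` currency, `HessKerDressedLimit.tendsto_limMKerOf_of_decays`), and the packaged ENDs
   **`entryHyps_perfCol`** / **`hasSum_transport_m2Tensor_perfCol`**: the column of the perfect `m`-step resolvent is an admissible transport weight at blocking `Lc^m`
   and transports second-moment tensors unchanged.
-/

namespace Summit.QuantumFields.BalabanUV.Beta.FP.TransportInfinityM

open Filter Topology Finset
open scoped BigOperators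
open Literature.MathematicalPhysics.QuantumFieldTheory.Balaban1983to89
open Literature.MathematicalPhysics.QuantumFieldTheory.Balaban1983to89.Beta
open B12Sec2to5 (l1 l1_nonneg Decay510)
open DecimatedMoment (cosetInd)
open DecimatedMomentSummable (ConstReproSum LinReproSum AbsMoment₂ absMoment₂_of_decay510)
open KernelSpecInstance (wH lowMomentsSum_specK)
open DressedMomentNormalisation (EKer m2Tensor coarseTensor dressedEntry EntryHyps coarseTensor_eq_m2Tensor)
open ExpKernelCalculus (MKer Decays)
open OneStepResolventKernel (Fib KInv decays_KInv)
open OneStepKernelFamily (dec legSet legPt legW LegIdx KInvStep sum_legW l1_neg_eq decays_dec')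
open HessianTelescopingKKT (legOff stepCol wStep KInv_inl_inr_zero constReproSum_dilate linReproSum_dilate constReproSum_const_mul
  linReproSum_const_mul absMoment₂_const_mul' hasSum_transport_m2Tensor)
open HessKerDressedLimit (limMKerOf limMKerOf_apply tendsto_limMKerOf_of_decays mker_sub_apply)
open Summit.QuantumFields.BalabanUV.Beta.HessKerDressedUnits (unitK unitK_apply legScale_inl legScale_inr)
open Summit.QuantumFields.BalabanUV.Beta.FP.PerfectObjects (KTot KTot_def KInvStep_eq_KTot)
open Summit.QuantumFields.BalabanUV.Beta.FP.PerfectObjectsT (KPerf)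
open Summit.QuantumFields.BalabanUV.Beta.FP.TransportLimit (constReproSum_of_tendsto)
open Summit.QuantumFields.BalabanUV.Beta.FP.TransportInfinity (summable_const_mul_exp_neg_l1 summable_abs_coord_mul_exp_neg_l1
  exists_linReproSum_of_tendsto)

noncomputable section

/-! ## §1 The `m`-step column at finite level: Strang–Fix data through `Lc^m • ℤ^{d+1}` -/

section Column

variable {d : ℕ} {Lc : ℕ} [NeZero Lc]

/-- [our object] **THE `ℋ`-COLUMN PATTERN OF THE (j, m)-RESOLVENT**: `stepColM Lc j m κ l p := KTot (Lc^(j+m)) (Lc^j) (−p) 0 (inl κ) (inr l)` — the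
`Lc^j`-decimated fine-field response of type `κ` at step-`j` relative position `−p` to the multiplier source of type `l` at the coarse origin of the
`m`-fold step (blocking `Lc^m` on the step-`j` lattice). -/
def stepColM (Lc : ℕ) [NeZero Lc] (j m : ℕ) (κ l : Fin (d + 1)) (p : Fin (d + 1) → ℤ) : ℝ :=
  KTot (d := d) (Lc ^ (j + m)) (Lc ^ j) (-p) 0 (Sum.inl κ) (Sum.inr l)

/-- [our object] `m = 1` is an4's one-step column: `stepColM Lc j 1 = stepCol Lc j` (`KInvStep_eq_KTot` is `rfl`). -/
theorem stepColM_one (j : ℕ) (κ l : Fin (d + 1)) : stepColM (d := d) Lc j 1 κ l = stepCol (d := d) Lc j κ l := rfl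

/-- [our object] UNFOLDING: the column is the block-contour MEAN (weights `(Lc^j)^{−(d+2)}`) of the `Lc^(j+m)`-level kernel `wH` over the leg offsets,
read at `legOff κ i − Lc^j • p`. -/
theorem stepColM_eq (j m : ℕ) (κ l : Fin (d + 1)) (p : Fin (d + 1) → ℤ) :
    stepColM (d := d) Lc j m κ l p = ∑ i ∈ LegIdx d (Lc ^ j),
      (((Lc ^ j : ℕ) : ℝ) ^ (d + 2))⁻¹ * wH (N := Lc ^ (j + m)) κ l (legOff κ i - ((Lc ^ j : ℕ) : ℤ) • p) := by
  unfold stepColM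
  rw [KTot_def]
  unfold OneStepKernelFamily.dec
  simp only [legSet, legW, legPt, Finset.sum_singleton, mul_one, smul_zero, KInv_inl_inr_zero, smul_neg]
  refine Finset.sum_congr rfl fun i _ => ?_
  rw [neg_add_eq_sub]
  rfl

/-- [our object] **CONSTANT REPRODUCTION OF THE `m`-STEP COLUMN THROUGH `Lc^m • ℤ^{d+1}` WITH THE MASS OF THE FINE KERNEL**: the `Lc^m`-coset sums of
`stepColM Lc j m κ l` are `δ_{κl} · (Lc^{j+m})^{−(d+2)}` — decimation by `Lc^j` averages `(Lc^j)^{d+2}` fine `Lc^{j+m}`-cosets of `wH_{Lc^{j+m}}`, each of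
Kronecker mass `(Lc^{j+m})^{−(d+2)}` (`KernelSpecInstance.lowMomentsSum_specK`), with weights `(Lc^j)^{−(d+2)}` (`constReproSum_dilate`, `(M, L) = (Lc^j, Lc^m)`). -/
theorem constReproSum_stepColM (j m : ℕ) (κ l : Fin (d + 1)) :
    ConstReproSum (Lc ^ m) (stepColM (d := d) Lc j m κ l)
      (if κ = l then ((((Lc ^ (j + m) : ℕ) : ℝ)) ^ (d + 1 + 1))⁻¹ else 0) := by
  intro a
  have hM : Lc ^ j ≠ 0 := pow_ne_zero _ (NeZero.ne Lc)
  have hw : ConstReproSum (Lc ^ j * Lc ^ m) (wH (N := Lc ^ (j + m)) κ l)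
      (if κ = l then ((((Lc ^ (j + m) : ℕ) : ℝ)) ^ (d + 1 + 1))⁻¹ else 0) := by
    rw [← pow_add]
    exact (lowMomentsSum_specK (N := Lc ^ (j + m))).1 κ l
  have hleg : ∀ i ∈ LegIdx d (Lc ^ j), HasSum (fun p : Fin (d + 1) → ℤ => cosetInd (Lc ^ m) (a - p) •
      ((((Lc ^ j : ℕ) : ℝ) ^ (d + 2))⁻¹ * wH (N := Lc ^ (j + m)) κ l (legOff κ i - ((Lc ^ j : ℕ) : ℤ) • p)))
      ((((Lc ^ j : ℕ) : ℝ) ^ (d + 2))⁻¹ * (if κ = l then ((((Lc ^ (j + m) : ℕ) : ℝ)) ^ (d + 1 + 1))⁻¹ else 0)) := by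
    intro i _
    refine ((constReproSum_dilate hM hw (legOff κ i) a).mul_left ((((Lc ^ j : ℕ) : ℝ) ^ (d + 2))⁻¹)).congr_fun fun p => ?_
    simp only [zsmul_eq_mul]
    ring
  have hs := hasSum_sum hleg
  have h1 : ∑ _i ∈ LegIdx d (Lc ^ j), (((Lc ^ j : ℕ) : ℝ) ^ (d + 2))⁻¹ = 1 := by
    have := sum_legW (d := d) hM (Sum.inl κ)
    simpa only [legSet, legW] using this
  rw [← Finset.sum_mul, h1, one_mul] at hs
  refine hs.congr_fun fun p => ?_
  rw [stepColM_eq, Finset.smul_sum]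

/-- [our object] **AFFINE REPRODUCTION OF THE `m`-STEP COLUMN THROUGH `Lc^m • ℤ^{d+1}`** (some coset-independent constants; `linReproSum_dilate`). -/
theorem linReproSum_stepColM (j m : ℕ) (κ l : Fin (d + 1)) :
    ∃ C : Fin (d + 1) → ℝ, LinReproSum (Lc ^ m) (stepColM (d := d) Lc j m κ l) C := by
  have hM : Lc ^ j ≠ 0 := pow_ne_zero _ (NeZero.ne Lc)
  set σ0 : ℝ := (if κ = l then ((((Lc ^ (j + m) : ℕ) : ℝ)) ^ (d + 1 + 1))⁻¹ else 0) with hσ0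
  have hw : ConstReproSum (Lc ^ j * Lc ^ m) (wH (N := Lc ^ (j + m)) κ l) σ0 := by
    rw [hσ0, ← pow_add]
    exact (lowMomentsSum_specK (N := Lc ^ (j + m))).1 κ l
  obtain ⟨C', hC'0⟩ := (lowMomentsSum_specK (N := Lc ^ (j + m))).2 κ l
  have hC' : LinReproSum (Lc ^ j * Lc ^ m) (wH (N := Lc ^ (j + m)) κ l) C' := by
    rw [← pow_add]
    exact hC'0
  refine ⟨fun μ => ∑ i ∈ LegIdx d (Lc ^ j), (((Lc ^ j : ℕ) : ℝ) ^ (d + 2))⁻¹ *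
    ((((Lc ^ j : ℕ) : ℝ))⁻¹ * (((legOff κ i μ : ℤ) : ℝ) * σ0 - C' μ)), fun a μ => ?_⟩
  have hleg : ∀ i ∈ LegIdx d (Lc ^ j), HasSum (fun p : Fin (d + 1) → ℤ => (cosetInd (Lc ^ m) (a - p) * p μ) •
      ((((Lc ^ j : ℕ) : ℝ) ^ (d + 2))⁻¹ * wH (N := Lc ^ (j + m)) κ l (legOff κ i - ((Lc ^ j : ℕ) : ℤ) • p)))
      ((((Lc ^ j : ℕ) : ℝ) ^ (d + 2))⁻¹ * ((((Lc ^ j : ℕ) : ℝ))⁻¹ * (((legOff κ i μ : ℤ) : ℝ) * σ0 - C' μ))) := by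
    intro i _
    refine (((linReproSum_dilate hM hw hC' (legOff κ i)) a μ).mul_left ((((Lc ^ j : ℕ) : ℝ) ^ (d + 2))⁻¹)).congr_fun
      fun p => ?_
    simp only [zsmul_eq_mul, Int.cast_mul]
    ring
  have hs := hasSum_sum hleg
  refine hs.congr_fun fun p => ?_
  rw [stepColM_eq, Finset.smul_sum]

/-- [our object] The (j, m)-resolvent decays exponentially (per `n`, `M`; `decays_dec'` of `decays_KInv`). -/
theorem decays_KTot (n M : ℕ) [NeZero n] (hM : 1 ≤ M) : ∃ δ C : ℝ, 0 < δ ∧ 0 ≤ C ∧ Decays (KTot (d := d) n M) C δ := by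
  rw [KTot_def]
  exact decays_dec' (decays_KInv (N := n) (d := d)) hM

/-- [our object] The `m`-step column has absolutely summable second moments (exponential decay of the (j, m)-resolvent). -/
theorem absMoment₂_stepColM (j m : ℕ) (κ l : Fin (d + 1)) : AbsMoment₂ (stepColM (d := d) Lc j m κ l) := by
  obtain ⟨δ, C, hδ, _, hK⟩ := decays_KTot (d := d) (Lc ^ (j + m)) (Lc ^ j)
    (Nat.one_le_iff_ne_zero.2 (pow_ne_zero _ (NeZero.ne Lc)))
  refine absMoment₂_of_decay510 hδ (C := C) fun p => ?_
  have h := hK (-p) 0 (Sum.inl κ) (Sum.inr l)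
  rw [sub_zero, l1_neg_eq] at h
  exact h

/-- [our object] **THE RENORMALISED `m`-STEP TRANSPORT WEIGHT** (`d = 3`): the column of the (j, m)-resolvent multiplied by `Lc^{5j}` (the bond-unit factor
`s_f·s_m` of the step-`j` lattice, an4's normalisation of `wStep`), so that its `Lc^m`-coset Kronecker mass is `(Lc^m)^{−5}` — the admissible normalisation of
`DressedMomentNormalisation.EntryHyps` at blocking `Lc^m`.  The family is indexed `j ↦ wStepM Lc m j` for the limit `j → ∞`. -/
def wStepM (Lc : ℕ) [NeZero Lc] (m j : ℕ) : EKer 4 := fun κ l p => (Lc : ℝ) ^ (5 * j) * stepColM (d := 3) Lc j m κ l p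

/-- [our object] `m = 1` is an4's canonical one-step weight: `wStepM Lc 1 = wStep Lc`. -/
theorem wStepM_one : wStepM Lc 1 = wStep Lc := rfl

/-- [our object] **(L0) FOR `wStepM`: Kronecker coset mass `(Lc^m)^{−5}` through `Lc^m • ℤ⁴`, at EVERY step `j`** (`(Lc^{j+m})^{−5} · Lc^{5j} = (Lc^m)^{−5}`). -/
theorem constReproSum_wStepM (m j : ℕ) (κ l : Fin 4) :
    ConstReproSum (Lc ^ m) (wStepM Lc m j κ l) (if κ = l then ((((Lc ^ m : ℕ) : ℝ) ^ (4 + 1))⁻¹) else 0) := by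
  have hL : (Lc : ℝ) ≠ 0 := by exact_mod_cast (NeZero.ne Lc)
  have h := constReproSum_const_mul (constReproSum_stepColM (d := 3) (Lc := Lc) j m κ l) ((Lc : ℝ) ^ (5 * j))
  have ev : (Lc : ℝ) ^ (5 * j) * (if κ = l then ((((Lc ^ (j + m) : ℕ) : ℝ)) ^ (3 + 1 + 1))⁻¹ else 0)
      = (if κ = l then ((((Lc ^ m : ℕ) : ℝ) ^ (4 + 1))⁻¹) else 0) := by
    split_ifs
    · push_cast
      have e : ((Lc : ℝ) ^ (j + m)) ^ (3 + 1 + 1) = (Lc : ℝ) ^ (5 * j) * ((Lc : ℝ) ^ m) ^ (4 + 1) := by ring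
      rw [e, mul_inv, ← mul_assoc, mul_inv_cancel₀ (pow_ne_zero _ hL), one_mul]
    · rw [mul_zero]
  rw [ev] at h
  exact h

/-- [our object] (L1) for `wStepM`. -/
theorem linReproSum_wStepM (m j : ℕ) (κ l : Fin 4) : ∃ C : Fin 4 → ℝ, LinReproSum (Lc ^ m) (wStepM Lc m j κ l) C := by
  obtain ⟨C, hC⟩ := linReproSum_stepColM (d := 3) (Lc := Lc) j m κ l
  exact ⟨_, linReproSum_const_mul hC ((Lc : ℝ) ^ (5 * j))⟩

/-- [our object] AbsMoment₂ for `wStepM`. -/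
theorem absMoment₂_wStepM (m j : ℕ) (κ l : Fin 4) : AbsMoment₂ (wStepM Lc m j κ l) :=
  absMoment₂_const_mul' (absMoment₂_stepColM (d := 3) (Lc := Lc) j m κ l) ((Lc : ℝ) ^ (5 * j))

/-- [our object] **FINITE-`j` ADMISSIBILITY AT BLOCKING `Lc^m`**: for ANY matrix kernel `𝒯` with absolutely summable second moments and (T0)/(T1),
the pair `(wStepM Lc m j, 𝒯)` satisfies `EntryHyps (Lc^m)` — so an4's `hasSum_transport_m2Tensor` transports `m2Tensor 𝒯` unchanged through the
(j, m)-resolvent's column. -/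
theorem entryHyps_wStepM (m j : ℕ) {𝒯 : EKer 4} (hA : ∀ c e, AbsMoment₂ (𝒯 c e)) (hT0 : ∀ c e, HasSum (𝒯 c e) 0)
    (hT1 : ∀ c e (μ : Fin 4), HasSum (fun t => t μ • 𝒯 c e t) 0) : EntryHyps (Lc ^ m) (wStepM Lc m j) 𝒯 :=
  ⟨pos_of_ne_zero (pow_ne_zero _ (NeZero.ne Lc)), constReproSum_wStepM m j, linReproSum_wStepM m j, absMoment₂_wStepM m j, hA, hT0, hT1⟩

end Column

/-! ## §2 The limit `j → ∞`: the perfect `m`-step transport is admissible and transports second-moment tensors unchanged -/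

section Limit

variable {Lc : ℕ} [NeZero Lc]

/-- [our object] A `j`-uniform exponential majorant passes to entrywise limits (`le_of_tendsto`). -/
theorem decay510_of_tendsto {D : ℕ} {w : ℕ → (Fin D → ℤ) → ℝ} {winf : (Fin D → ℤ) → ℝ} {A δ : ℝ}
    (hbound : ∀ j u, |w j u| ≤ A * Real.exp (-δ * l1 u)) (hlim : ∀ u, Tendsto (fun j => w j u) atTop (𝓝 (winf u))) :
    Decay510 winf A δ := fun u =>
  le_of_tendsto ((continuous_abs.tendsto _).comp (hlim u)) (Eventually.of_forall fun j => hbound j u)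

variable (m : ℕ) {wInf : EKer 4} {A δ : ℝ}

/-- [our object] **THE PERFECT `m`-STEP TRANSPORT REPRODUCES CONSTANTS, COSET MASS `(Lc^m)^{−5}`**: for ANY entrywise limit `wInf κ l` of
`j ↦ wStepM Lc m j κ l` under a `j`-uniform exponential majorant, `ConstReproSum (Lc^m) (wInf κ l) (δ_{κl}·((Lc^m)^{4+1})⁻¹)` — the mass of EVERY
finite `j` (`constReproSum_wStepM`) survives the limit (`FP/TransportLimit.constReproSum_of_tendsto`). -/
theorem constReproSum_of_tendsto_wStepM (hδ : 0 < δ) (hbound : ∀ j κ l u, |wStepM Lc m j κ l u| ≤ A * Real.exp (-δ * l1 u))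
    (hlim : ∀ κ l u, Tendsto (fun j => wStepM Lc m j κ l u) atTop (𝓝 (wInf κ l u))) (κ l : Fin 4) :
    ConstReproSum (Lc ^ m) (wInf κ l) (if κ = l then ((((Lc ^ m : ℕ) : ℝ) ^ (4 + 1))⁻¹) else 0) :=
  constReproSum_of_tendsto (w := fun j => wStepM Lc m j κ l) (σ := fun _ => if κ = l then ((((Lc ^ m : ℕ) : ℝ) ^ (4 + 1))⁻¹) else 0)
    (summable_const_mul_exp_neg_l1 A hδ) (fun j u => hbound j κ l u) (hlim κ l) (fun j => constReproSum_wStepM m j κ l)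
    tendsto_const_nhds

/-- [our object] **THE PERFECT `m`-STEP TRANSPORT REPRODUCES LINEAR DATA** (same hypotheses, `A ≥ 0`): `∃ C, LinReproSum (Lc^m) (wInf κ l) C`. -/
theorem exists_linReproSum_of_tendsto_wStepM (hA : 0 ≤ A) (hδ : 0 < δ)
    (hbound : ∀ j κ l u, |wStepM Lc m j κ l u| ≤ A * Real.exp (-δ * l1 u))
    (hlim : ∀ κ l u, Tendsto (fun j => wStepM Lc m j κ l u) atTop (𝓝 (wInf κ l u))) (κ l : Fin 4) :
    ∃ C : Fin 4 → ℝ, LinReproSum (Lc ^ m) (wInf κ l) C :=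
  exists_linReproSum_of_tendsto (w := fun j => wStepM Lc m j κ l) (summable_abs_coord_mul_exp_neg_l1 hA hδ)
    (fun j u => hbound j κ l u) (hlim κ l) (fun j => linReproSum_wStepM m j κ l)

/-- [our object] The perfect `m`-step transport has absolutely summable second moments (it inherits the exponential majorant). -/
theorem absMoment₂_of_tendsto_wStepM (hδ : 0 < δ) (hbound : ∀ j κ l u, |wStepM Lc m j κ l u| ≤ A * Real.exp (-δ * l1 u))
    (hlim : ∀ κ l u, Tendsto (fun j => wStepM Lc m j κ l u) atTop (𝓝 (wInf κ l u))) (κ l : Fin 4) :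
    AbsMoment₂ (wInf κ l) :=
  absMoment₂_of_decay510 hδ (decay510_of_tendsto (fun j u => hbound j κ l u) (hlim κ l))

/-- [our object] **THE PERFECT `m`-STEP TRANSPORT IS ADMISSIBLE AT BLOCKING `Lc^m`**: `EntryHyps (Lc^m) wInf 𝒯` for ANY kernel `𝒯` with absolutely
summable second moments and (T0)/(T1). -/
theorem entryHyps_of_tendsto_wStepM (hA : 0 ≤ A) (hδ : 0 < δ)
    (hbound : ∀ j κ l u, |wStepM Lc m j κ l u| ≤ A * Real.exp (-δ * l1 u))
    (hlim : ∀ κ l u, Tendsto (fun j => wStepM Lc m j κ l u) atTop (𝓝 (wInf κ l u)))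
    {𝒯 : EKer 4} (hT : ∀ c e, AbsMoment₂ (𝒯 c e)) (hT0 : ∀ c e, HasSum (𝒯 c e) 0)
    (hT1 : ∀ c e (μ : Fin 4), HasSum (fun t => t μ • 𝒯 c e t) 0) : EntryHyps (Lc ^ m) wInf 𝒯 :=
  ⟨pos_of_ne_zero (pow_ne_zero _ (NeZero.ne Lc)), constReproSum_of_tendsto_wStepM m hδ hbound hlim,
    exists_linReproSum_of_tendsto_wStepM m hA hδ hbound hlim, absMoment₂_of_tendsto_wStepM m hδ hbound hlim, hT, hT0, hT1⟩

/-- [our object] **TRANSPORT INVARIANCE OF THE SECOND-MOMENT TENSOR AT THE FIXED POINT** (`HasSum` form): the `(Lc^m)^8`-rescaled, `Lc^m`-decimated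
dressing of `𝒯` by the perfect `m`-step transport on both legs has the second-moment tensor OF `𝒯` (an4's `hasSum_transport_m2Tensor` with `w := wInf`). -/
theorem hasSum_transport_m2Tensor_of_tendsto_wStepM (hA : 0 ≤ A) (hδ : 0 < δ)
    (hbound : ∀ j κ l u, |wStepM Lc m j κ l u| ≤ A * Real.exp (-δ * l1 u))
    (hlim : ∀ κ l u, Tendsto (fun j => wStepM Lc m j κ l u) atTop (𝓝 (wInf κ l u)))
    {𝒯 : EKer 4} (hT : ∀ c e, AbsMoment₂ (𝒯 c e)) (hT0 : ∀ c e, HasSum (𝒯 c e) 0)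
    (hT1 : ∀ c e (μ : Fin 4), HasSum (fun t => t μ • 𝒯 c e t) 0) (κ lam a b : Fin 4) :
    HasSum (fun z : Fin 4 → ℤ => (z κ * z lam) • ((((Lc ^ m : ℕ) : ℝ)) ^ 8 * dressedEntry wInf 𝒯 (((Lc ^ m : ℕ) : ℤ) • z) a b))
      (m2Tensor 𝒯 κ lam a b) :=
  hasSum_transport_m2Tensor (entryHyps_of_tendsto_wStepM m hA hδ hbound hlim hT hT0 hT1) κ lam a b

/-- [our object] **TRANSPORT INVARIANCE, TENSOR FORM**: `coarseTensor (Lc^m) wInf 𝒯 = m2Tensor 𝒯` (`coarseTensor_eq_m2Tensor` BY NAME). -/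
theorem coarseTensor_eq_m2Tensor_of_tendsto_wStepM (hA : 0 ≤ A) (hδ : 0 < δ)
    (hbound : ∀ j κ l u, |wStepM Lc m j κ l u| ≤ A * Real.exp (-δ * l1 u))
    (hlim : ∀ κ l u, Tendsto (fun j => wStepM Lc m j κ l u) atTop (𝓝 (wInf κ l u)))
    {𝒯 : EKer 4} (hT : ∀ c e, AbsMoment₂ (𝒯 c e)) (hT0 : ∀ c e, HasSum (𝒯 c e) 0)
    (hT1 : ∀ c e (μ : Fin 4), HasSum (fun t => t μ • 𝒯 c e t) 0) : coarseTensor (Lc ^ m) wInf 𝒯 = m2Tensor 𝒯 :=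
  coarseTensor_eq_m2Tensor (entryHyps_of_tendsto_wStepM m hA hδ hbound hlim hT hT0 hT1)

end Limit

/-! ## §3 Dictionary: the column of the unit-rescaled (j, m)-resolvents and of the perfect `m`-step resolvent `KPerf … m` -/

section Dictionary

variable {Lc : ℕ} [NeZero Lc]

/-- [our object] The `(inl, inr)` entries of `D K D` carry the factor `s_f·s_m`. -/
theorem unitK_apply_inl_inr {d : ℕ} (sf sm : ℝ) (K : MKer (d + 1) (Fib d)) (x y : Fin (d + 1) → ℤ) (κ l : Fin (d + 1)) :
    unitK sf sm K x y (Sum.inl κ) (Sum.inr l) = sf * sm * K x y (Sum.inl κ) (Sum.inr l) := by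
  rw [unitK_apply, legScale_inl, legScale_inr]; ring

/-- [our object] **BOND UNITS**: if `s_f(j)·s_m(j) = Lc^{5j}` then the `(inl κ, inr l)` entry at `(−p, 0)` of the unit-rescaled (j, m)-resolvent
`unitK (sf j) (sm j) (KTot (Lc^(j+m)) (Lc^j))` IS `wStepM Lc m j κ l p`. -/
theorem unitK_KTot_column {sf sm : ℕ → ℝ} (hunit : ∀ j, sf j * sm j = (Lc : ℝ) ^ (5 * j)) (m j : ℕ) (κ l : Fin 4)
    (p : Fin 4 → ℤ) :
    unitK (sf j) (sm j) (KTot (d := 3) (Lc ^ (j + m)) (Lc ^ j)) (-p) 0 (Sum.inl κ) (Sum.inr l) = wStepM Lc m j κ l p := by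
  rw [unitK_apply_inl_inr, hunit]
  rfl

/-- [our object] The column read off a packed kernel: `colOf K κ l p := K (−p) 0 (inl κ) (inr l)` (an4's `stepCol` sign convention;
= `OneStepKernelFamily.colH K N l 0 κ (−p)` for any `N`). -/
def colOf (K : MKer (3 + 1) (Fib 3)) : EKer 4 := fun κ l p => K (-p) 0 (Sum.inl κ) (Sum.inr l)

/-- [our object] Unfolding of `colOf`. -/
theorem colOf_apply (K : MKer (3 + 1) (Fib 3)) (κ l : Fin 4) (p : Fin 4 → ℤ) :
    colOf K κ l p = K (-p) 0 (Sum.inl κ) (Sum.inr l) := rfl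

/-- [our object] In bond units the weight family IS the column family of the rescaled resolvents: `wStepM Lc m j = colOf (unitK … (KTot …))`. -/
theorem wStepM_eq_colOf {sf sm : ℕ → ℝ} (hunit : ∀ j, sf j * sm j = (Lc : ℝ) ^ (5 * j)) (m j : ℕ) :
    wStepM Lc m j = colOf (unitK (sf j) (sm j) (KTot (d := 3) (Lc ^ (j + m)) (Lc ^ j))) := by
  funext κ l p
  rw [colOf_apply, unitK_KTot_column hunit]

/-- [our object] **THE MAJORANT FROM A `j`-UNIFORM `Decays` BOUND** of the rescaled (j, m)-resolvents (the (CONV-C)-type uniform bound, cf. the binder `hK`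
of `FP/PerfectObjectsT.d1Drift_JsBalOf_of_perfect_step_law_bounded` at `m = 1`). -/
theorem abs_wStepM_le_of_decays {sf sm : ℕ → ℝ} (hunit : ∀ j, sf j * sm j = (Lc : ℝ) ^ (5 * j)) (m : ℕ) {C δK : ℝ}
    (hK : ∀ j, Decays (unitK (sf j) (sm j) (KTot (d := 3) (Lc ^ (j + m)) (Lc ^ j))) C δK) (j : ℕ) (κ l : Fin 4)
    (u : Fin 4 → ℤ) : |wStepM Lc m j κ l u| ≤ C * Real.exp (-δK * l1 u) := by
  have h := hK j (-u) 0 (Sum.inl κ) (Sum.inr l)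
  rw [sub_zero, l1_neg_eq, unitK_KTot_column hunit] at h
  exact h

/-- [our object] **ENTRYWISE CONVERGENCE OF THE RESCALED (j, m)-RESOLVENTS ⇒ CONVERGENCE OF THE WEIGHTS** to the column of the limit kernel (X1m, Tendsto form). -/
theorem tendsto_wStepM_of_tendsto {sf sm : ℕ → ℝ} (hunit : ∀ j, sf j * sm j = (Lc : ℝ) ^ (5 * j)) (m : ℕ) {Kinf : MKer (3 + 1) (Fib 3)}
    (hconv : ∀ x y a b, Tendsto (fun j => unitK (sf j) (sm j) (KTot (d := 3) (Lc ^ (j + m)) (Lc ^ j)) x y a b) atTop (𝓝 (Kinf x y a b)))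
    (κ l : Fin 4) (u : Fin 4 → ℤ) : Tendsto (fun j => wStepM Lc m j κ l u) atTop (𝓝 (colOf Kinf κ l u)) := by
  simp only [← unitK_KTot_column hunit, colOf_apply]
  exact hconv (-u) 0 (Sum.inl κ) (Sum.inr l)

/-- [our object] **THE SAME IN THE CELL'S ALL-SCALES `Decays` CURRENCY**: all-scales deviations `Decays (F (k+j) − F k) (c θ^k) δ`, `θ < 1`, of the rescaled
family `F j := unitK (sf j) (sm j) (KTot (Lc^(j+m)) (Lc^j))` ⇒ the weights converge to the column of the perfect `m`-step resolvent `KPerf Lc sf sm m`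
(= `limMKerOf F` by definition; `HessKerDressedLimit.tendsto_limMKerOf_of_decays`). -/
theorem tendsto_wStepM_of_decays {sf sm : ℕ → ℝ} (hunit : ∀ j, sf j * sm j = (Lc : ℝ) ^ (5 * j)) (m : ℕ) {c δ θ : ℝ}
    (hKall : ∀ k j, Decays (unitK (sf (k + j)) (sm (k + j)) (KTot (d := 3) (Lc ^ (k + j + m)) (Lc ^ (k + j)))
      - unitK (sf k) (sm k) (KTot (d := 3) (Lc ^ (k + m)) (Lc ^ k))) (c * θ ^ k) δ) (hθ1 : θ < 1)
    (κ l : Fin 4) (u : Fin 4 → ℤ) :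
    Tendsto (fun j => wStepM Lc m j κ l u) atTop (𝓝 (colOf (KPerf (d := 3) Lc sf sm m) κ l u)) :=
  tendsto_wStepM_of_tendsto hunit m
    (tendsto_limMKerOf_of_decays (K := fun j => unitK (sf j) (sm j) (KTot (d := 3) (Lc ^ (j + m)) (Lc ^ j))) hKall hθ1) κ l u

variable {sf sm : ℕ → ℝ} (hunit : ∀ j, sf j * sm j = (Lc : ℝ) ^ (5 * j)) (m : ℕ) {Kinf : MKer (3 + 1) (Fib 3)} {C δK : ℝ}
include hunit

/-- [our object] **THE COLUMN OF THE LIMIT KERNEL IS AN ADMISSIBLE TRANSPORT WEIGHT AT BLOCKING `Lc^m`** (X1m data in Tendsto form + the uniform `Decays`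
bound, bond units): `EntryHyps (Lc^m) (colOf Kinf) 𝒯` for ANY `𝒯` with AbsMoment₂/(T0)/(T1).  With `Kinf := KPerf Lc sf sm m` (its defining family
converging entrywise) this is the admissibility of the perfect `m`-step transport. -/
theorem entryHyps_colOf (hC : 0 ≤ C) (hδK : 0 < δK)
    (hK : ∀ j, Decays (unitK (sf j) (sm j) (KTot (d := 3) (Lc ^ (j + m)) (Lc ^ j))) C δK)
    (hconv : ∀ x y a b, Tendsto (fun j => unitK (sf j) (sm j) (KTot (d := 3) (Lc ^ (j + m)) (Lc ^ j)) x y a b) atTop (𝓝 (Kinf x y a b)))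
    {𝒯 : EKer 4} (hT : ∀ c e, AbsMoment₂ (𝒯 c e)) (hT0 : ∀ c e, HasSum (𝒯 c e) 0)
    (hT1 : ∀ c e (μ : Fin 4), HasSum (fun t => t μ • 𝒯 c e t) 0) : EntryHyps (Lc ^ m) (colOf Kinf) 𝒯 :=
  entryHyps_of_tendsto_wStepM m hC hδK (abs_wStepM_le_of_decays hunit m hK) (tendsto_wStepM_of_tendsto hunit m hconv) hT hT0 hT1

/-- [our object] **TRANSPORT INVARIANCE THROUGH THE COLUMN OF THE LIMIT KERNEL**: `coarseTensor (Lc^m) (colOf Kinf) 𝒯 = m2Tensor 𝒯`. -/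
theorem coarseTensor_colOf_eq_m2Tensor (hC : 0 ≤ C) (hδK : 0 < δK)
    (hK : ∀ j, Decays (unitK (sf j) (sm j) (KTot (d := 3) (Lc ^ (j + m)) (Lc ^ j))) C δK)
    (hconv : ∀ x y a b, Tendsto (fun j => unitK (sf j) (sm j) (KTot (d := 3) (Lc ^ (j + m)) (Lc ^ j)) x y a b) atTop (𝓝 (Kinf x y a b)))
    {𝒯 : EKer 4} (hT : ∀ c e, AbsMoment₂ (𝒯 c e)) (hT0 : ∀ c e, HasSum (𝒯 c e) 0)
    (hT1 : ∀ c e (μ : Fin 4), HasSum (fun t => t μ • 𝒯 c e t) 0) : coarseTensor (Lc ^ m) (colOf Kinf) 𝒯 = m2Tensor 𝒯 :=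
  coarseTensor_eq_m2Tensor (entryHyps_colOf hunit m hC hδK hK hconv hT hT0 hT1)

/-- [our object] **THE PERFECT `m`-STEP RESOLVENT'S COLUMN IS ADMISSIBLE** (all-scales `Decays` currency: uniform bound `hK` + deviations `hKall`, `θ < 1`):
`EntryHyps (Lc^m) (colOf (KPerf Lc sf sm m)) 𝒯`. -/
theorem entryHyps_perfCol (hC : 0 ≤ C) (hδK : 0 < δK)
    (hK : ∀ j, Decays (unitK (sf j) (sm j) (KTot (d := 3) (Lc ^ (j + m)) (Lc ^ j))) C δK) {c δ θ : ℝ}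
    (hKall : ∀ k j, Decays (unitK (sf (k + j)) (sm (k + j)) (KTot (d := 3) (Lc ^ (k + j + m)) (Lc ^ (k + j)))
      - unitK (sf k) (sm k) (KTot (d := 3) (Lc ^ (k + m)) (Lc ^ k))) (c * θ ^ k) δ) (hθ1 : θ < 1)
    {𝒯 : EKer 4} (hT : ∀ c e, AbsMoment₂ (𝒯 c e)) (hT0 : ∀ c e, HasSum (𝒯 c e) 0)
    (hT1 : ∀ c e (μ : Fin 4), HasSum (fun t => t μ • 𝒯 c e t) 0) :
    EntryHyps (Lc ^ m) (colOf (KPerf (d := 3) Lc sf sm m)) 𝒯 :=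
  entryHyps_of_tendsto_wStepM m hC hδK (abs_wStepM_le_of_decays hunit m hK) (tendsto_wStepM_of_decays hunit m hKall hθ1) hT hT0 hT1

/-- [our object] **TRANSPORT INVARIANCE THROUGH THE PERFECT `m`-STEP RESOLVENT'S COLUMN** (`HasSum` form, an4's `hasSum_transport_m2Tensor` shape):
the second-moment tensor of `(Lc^m)^8 · dressedEntry (colOf (KPerf … m)) 𝒯 (Lc^m • ·)` IS `m2Tensor 𝒯`. -/
theorem hasSum_transport_m2Tensor_perfCol (hC : 0 ≤ C) (hδK : 0 < δK)
    (hK : ∀ j, Decays (unitK (sf j) (sm j) (KTot (d := 3) (Lc ^ (j + m)) (Lc ^ j))) C δK) {c δ θ : ℝ}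
    (hKall : ∀ k j, Decays (unitK (sf (k + j)) (sm (k + j)) (KTot (d := 3) (Lc ^ (k + j + m)) (Lc ^ (k + j)))
      - unitK (sf k) (sm k) (KTot (d := 3) (Lc ^ (k + m)) (Lc ^ k))) (c * θ ^ k) δ) (hθ1 : θ < 1)
    {𝒯 : EKer 4} (hT : ∀ c e, AbsMoment₂ (𝒯 c e)) (hT0 : ∀ c e, HasSum (𝒯 c e) 0)
    (hT1 : ∀ c e (μ : Fin 4), HasSum (fun t => t μ • 𝒯 c e t) 0) (κ lam a b : Fin 4) :
    HasSum (fun z : Fin 4 → ℤ => (z κ * z lam) •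
        ((((Lc ^ m : ℕ) : ℝ)) ^ 8 * dressedEntry (colOf (KPerf (d := 3) Lc sf sm m)) 𝒯 (((Lc ^ m : ℕ) : ℤ) • z) a b))
      (m2Tensor 𝒯 κ lam a b) :=
  hasSum_transport_m2Tensor (entryHyps_perfCol hunit m hC hδK hK hKall hθ1 hT hT0 hT1) κ lam a b

/-- [our object] **TRANSPORT INVARIANCE THROUGH THE PERFECT `m`-STEP RESOLVENT'S COLUMN, TENSOR FORM**:
`coarseTensor (Lc^m) (colOf (KPerf Lc sf sm m)) 𝒯 = m2Tensor 𝒯`. -/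
theorem coarseTensor_perfCol_eq_m2Tensor (hC : 0 ≤ C) (hδK : 0 < δK)
    (hK : ∀ j, Decays (unitK (sf j) (sm j) (KTot (d := 3) (Lc ^ (j + m)) (Lc ^ j))) C δK) {c δ θ : ℝ}
    (hKall : ∀ k j, Decays (unitK (sf (k + j)) (sm (k + j)) (KTot (d := 3) (Lc ^ (k + j + m)) (Lc ^ (k + j)))
      - unitK (sf k) (sm k) (KTot (d := 3) (Lc ^ (k + m)) (Lc ^ k))) (c * θ ^ k) δ) (hθ1 : θ < 1)
    {𝒯 : EKer 4} (hT : ∀ c e, AbsMoment₂ (𝒯 c e)) (hT0 : ∀ c e, HasSum (𝒯 c e) 0)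
    (hT1 : ∀ c e (μ : Fin 4), HasSum (fun t => t μ • 𝒯 c e t) 0) :
    coarseTensor (Lc ^ m) (colOf (KPerf (d := 3) Lc sf sm m)) 𝒯 = m2Tensor 𝒯 :=
  coarseTensor_eq_m2Tensor (entryHyps_perfCol hunit m hC hδK hK hKall hθ1 hT hT0 hT1)

end Dictionary

end

end Summit.QuantumFields.BalabanUV.Beta.FP.TransportInfinityM
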